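import Mathlib.LinearAlgebra.QuadraticForm.Basic
import Mathlib.LinearAlgebra.BilinearForm.Orthogonal
import Mathlib.LinearAlgebra.FiniteDimensional.Lemmas
import Mathlib.Algebra.Module.Projective
import Literature.GroupTheory.FiniteAbelian.AlternatingPairing
import HarnessLib

/-!
# Metabolic quadratic spaces and Lagrangian subspaces (Klagsbrun–Mazur–Rubin §2)

Z. Klagsbrun, B. Mazur, K. Rubin, *Disparity in Selmer ranks of quadratic twists of elliptic curves*,
Ann. of Math. 178 (2013), §2 = arXiv:1111.2321 §2, sequential numbers Def. 1, Lemma 2, Lemma 3, Prop. 4,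
Cor. 5 in the held corpus text `paper:arxiv-1111.2321` (chunk p0006); the linear algebra behind the
relative parity of Selmer ranks (Thm. 3.9 = sequential Thm. 14, chunks p0007–p0008). Everything is PROVED,
over an arbitrary field `F` (KMR: `𝔽_p`, `p = 2` allowed — the statements are about a quadratic form
`q`, not only its polar pairing, exactly so that characteristic `2` is covered):

* `IsTotallyIsotropic Q X` (`q(X) = 0`), `IsLagrangian Q X` (Def. 2.1: `X = X^⊥` for the polar
  pairing `(v, w)_q = q(v + w) − q(v) − q(w)` and `q(X) = 0`), `IsMetabolic Q` (Def. 2.1: the polar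
  pairing is nondegenerate and a Lagrangian subspace exists — "`(V, q)` is a metabolic space");
* `IsLagrangian.two_mul_finrank` (`2 dim X = dim V`) and the converse
  `isLagrangian_of_isTotallyIsotropic_of_two_mul_finrank_eq` (isotropic + half-dimensional ⇒ Lagrangian);
* `orthogonal_sup_eq_inf`, `orthogonal_inf_eq_sup` (`(A ∩ B)^⊥ = A^⊥ + B^⊥` for a nondegenerate
  reflexive form);
* Lemma 2.2 `isLagrangian_orthogonal_inf_sup`: `X` Lagrangian, `q(W) = 0` ⇒ `W^⊥ ∩ X + W` Lagrangian;
* Lemma 2.3 `even_finrank_sup_inf_add_finrank_inf_sup_inf`: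
  `dim ((X+Y) ∩ Z) ≡ dim (X ∩ Z + Y ∩ Z) (mod 2)` for Lagrangians `X, Y, Z` (the alternating pairing
  `[z, z'] = (x, y')_q` on `(X+Y) ∩ Z`, nondegenerate modulo `X ∩ Z + Y ∩ Z`; evenness from the tree's
  `even_finrank_of_isAlt_of_nondegenerate`);
* Prop. 2.4 `even_finrank_inf_add_finrank_inf_add_finrank_inf_add_finrank`:
  `dim X∩Y + dim Y∩Z + dim X∩Z ≡ dim X (mod 2)`, and Cor. 2.5;
* `threeLagrangianParity` — Prop. 2.4 in the shape of the stub `stub_threeLagrangianParity` of the crux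
  lines on `stmt-Parity-11584` (nondegeneracy as left-separation of the polar form, Lagrangian as
  isotropic + half-dimensional), for every field (the stub is its instance `F = ZMod 2`);
* `even_finrank_comap_add_finrank_comap_add_finrank_sub` — the ALGEBRAIC SKELETON of KMR Thm. 3.9
  (relative parity of Selmer ranks): for `loc : H → V` with Lagrangian image `Z` and Lagrangians `X, Y`,
  `dim loc⁻¹(X) + dim loc⁻¹(Y) + dim X/(X ∩ Y)` is even (Thm. 3.9 is this with `V = ⊕_{v∈Σ'} H¹(K_v,T)`,
  `X, Y` the local conditions, `Z = loc(H¹(K_{Σ'}/K,T))`, whose Lagrangian property is the arithmetic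
  input: local Tate duality, Poitou–Tate, reciprocity). The arithmetic statement itself (Tate quadratic
  forms, Def. 3.1–3.2, on the tree's `galoisCohomology`) is not vendored here: the tree has no
  `𝔽_p`-structure on `H¹(K_v, T)` nor the local Tate pairing as an object.
-/

noncomputable section

namespace Literature.LinearAlgebra.QuadraticForm

open Module QuadraticMap

variable {F : Type*} [Field F] {V : Type*} [AddCommGroup V] [Module F V]

/-! ### Definitions -/

/-- `q(X) = 0`: the quadratic form vanishes identically on the subspace `X` ("`q(W) = 0`" in KMR §2).
[cite: KlagsbrunMazurRubin2013, Def. 2.1 (arXiv §2 Def. 1)] -/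
def IsTotallyIsotropic (Q : QuadraticForm F V) (X : Submodule F V) : Prop :=
  ∀ x ∈ X, Q x = 0

/-- The polar pairing `(v, w)_q = q(v + w) − q(v) − q(w)` of a quadratic form, as a bilinear form
(Mathlib's `QuadraticMap.polarBilin`, typed as `LinearMap.BilinForm`). [cite: KlagsbrunMazurRubin2013, Def. 2.1] -/
abbrev polarForm (Q : QuadraticForm F V) : LinearMap.BilinForm F V := polarBilin Q

/-- `polarForm Q v w = polar Q v w`. [folklore] -/
@[simp] theorem polarForm_apply (Q : QuadraticForm F V) (x y : V) : polarForm Q x y = polar Q x y := rfl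

/-- **Lagrangian subspace** (KMR Def. 2.1): `X = X^⊥` for the polar pairing `(v, w)_q = q(v+w) − q(v) − q(w)`
(right orthogonal complement `LinearMap.BilinForm.orthogonal` of the polar form) and `q(X) = 0`.
[cite: KlagsbrunMazurRubin2013, Def. 2.1 (arXiv §2 Def. 1)] -/
def IsLagrangian (Q : QuadraticForm F V) (X : Submodule F V) : Prop :=
  (polarForm Q).orthogonal X = X ∧ IsTotallyIsotropic Q X

/-- **Metabolic space** (KMR Def. 2.1: "we say that `(V, q)` is a metabolic space if `( , )_q` is
nondegenerate and `V` has a subspace `X` such that `X = X^⊥` and `q(X) = 0`").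
[cite: KlagsbrunMazurRubin2013, Def. 2.1 (arXiv §2 Def. 1)] -/
def IsMetabolic (Q : QuadraticForm F V) : Prop :=
  (polarForm Q).Nondegenerate ∧ ∃ X : Submodule F V, IsLagrangian Q X

variable (Q : QuadraticForm F V)

/-! ### The polar pairing -/

/-- The polar pairing is symmetric. [folklore] -/
theorem polarForm_isSymm : (polarForm Q).IsSymm :=
  ⟨fun x y => polar_comm Q x y⟩

/-- The polar pairing is reflexive. [folklore] -/
theorem polarForm_isRefl : (polarForm Q).IsRefl :=
  (polarForm_isSymm Q).isRefl

/-- `q(x + y) = q(x) + q(y) + (x, y)_q`. [folklore] -/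
theorem map_add_eq_polar (x y : V) : Q (x + y) = Q x + Q y + polar Q x y := by
  rw [polar]
  abel

/-- Nondegeneracy of the (symmetric) polar pairing is left-separation: `(x, ·)_q = 0 ⇒ x = 0`.
[folklore] -/
theorem polarForm_nondegenerate_iff :
    (polarForm Q).Nondegenerate ↔ ∀ x : V, (∀ y : V, polar Q x y = 0) → x = 0 := by
  rw [LinearMap.BilinForm.Nondegenerate, (polarForm_isRefl Q).nondegenerate_iff_separatingLeft]
  rfl

variable {Q}

/-! ### Totally isotropic subspaces -/

namespace IsTotallyIsotropic

/-- On a totally isotropic subspace the polar pairing vanishes. [folklore] -/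
theorem polar_eq_zero {X : Submodule F V} (h : IsTotallyIsotropic Q X) {x y : V} (hx : x ∈ X)
    (hy : y ∈ X) : polar Q x y = 0 := by
  rw [polar, h _ (X.add_mem hx hy), h x hx, h y hy, sub_zero, sub_zero]

/-- A totally isotropic subspace is contained in its orthogonal complement. [folklore] -/
theorem le_orthogonal {X : Submodule F V} (h : IsTotallyIsotropic Q X) :
    X ≤ (polarForm Q).orthogonal X := fun x hx =>
  LinearMap.BilinForm.mem_orthogonal_iff.2 fun y hy => by
    rw [polarForm_apply]
    exact h.polar_eq_zero hy hx

/-- Subspaces of totally isotropic subspaces are totally isotropic. [folklore] -/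
theorem mono {X Y : Submodule F V} (h : IsTotallyIsotropic Q Y) (hXY : X ≤ Y) :
    IsTotallyIsotropic Q X := fun x hx => h x (hXY hx)

/-- The sum of two mutually orthogonal totally isotropic subspaces is totally isotropic. [folklore] -/
theorem sup {X W : Submodule F V} (hX : IsTotallyIsotropic Q X) (hW : IsTotallyIsotropic Q W)
    (hXW : ∀ x ∈ X, ∀ w ∈ W, polar Q x w = 0) : IsTotallyIsotropic Q (X ⊔ W) := by
  intro v hv
  obtain ⟨x, hx, w, hw, rfl⟩ := Submodule.mem_sup.1 hv
  rw [map_add_eq_polar, hX x hx, hW w hw, hXW x hx w hw, add_zero, add_zero]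

end IsTotallyIsotropic

/-! ### Lagrangian subspaces -/

namespace IsLagrangian

variable {X : Submodule F V}

/-- A Lagrangian subspace is its own orthogonal complement. [cite: KlagsbrunMazurRubin2013, Def. 2.1] -/
theorem orthogonal_eq (h : IsLagrangian Q X) : (polarForm Q).orthogonal X = X := h.1

/-- A Lagrangian subspace is totally isotropic. [cite: KlagsbrunMazurRubin2013, Def. 2.1] -/
theorem isTotallyIsotropic (h : IsLagrangian Q X) : IsTotallyIsotropic Q X := h.2

/-- `v ⊥ X ⇒ v ∈ X` for a Lagrangian `X`. [cite: KlagsbrunMazurRubin2013, Def. 2.1] -/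
theorem mem_of_forall_polar_eq_zero (h : IsLagrangian Q X) {v : V} (hv : ∀ x ∈ X, polar Q x v = 0) :
    v ∈ X := by
  rw [← h.orthogonal_eq]
  exact LinearMap.BilinForm.mem_orthogonal_iff.2 fun x hx => by
    rw [polarForm_apply]
    exact hv x hx

/-- **Lagrangians are half-dimensional**: `2 dim X = dim V` for a Lagrangian `X` of a nondegenerate
form ("all Lagrangian subspaces have the same dimension `½ dim V`", KMR proof of Prop. 2.4).
[cite: KlagsbrunMazurRubin2013, §2 (proof of Prop. 2.4)] -/
theorem two_mul_finrank [FiniteDimensional F V] (hnd : (polarForm Q).Nondegenerate)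
    (h : IsLagrangian Q X) : 2 * finrank F X = finrank F V := by
  have h1 := LinearMap.BilinForm.finrank_orthogonal hnd X
  rw [h.orthogonal_eq] at h1
  have h2 : finrank F X ≤ finrank F V := Submodule.finrank_le X
  omega

end IsLagrangian

/-- **Isotropic + half-dimensional ⇒ Lagrangian** (for a nondegenerate form): the converse of
`IsLagrangian.two_mul_finrank`. [cite: KlagsbrunMazurRubin2013, §2 (proof of Prop. 2.4)] -/
theorem isLagrangian_of_isTotallyIsotropic_of_two_mul_finrank_eq [FiniteDimensional F V]
    (hnd : (polarForm Q).Nondegenerate) {X : Submodule F V} (hX : IsTotallyIsotropic Q X)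
    (hdim : 2 * finrank F X = finrank F V) : IsLagrangian Q X := by
  refine ⟨?_, hX⟩
  symm
  refine Submodule.eq_of_le_of_finrank_le hX.le_orthogonal ?_
  rw [LinearMap.BilinForm.finrank_orthogonal hnd X]
  omega

/-! ### Orthogonal complements of sums and intersections -/

/-- `(A + B)^⊥ = A^⊥ ∩ B^⊥`. [folklore] -/
theorem orthogonal_sup_eq_inf (B : LinearMap.BilinForm F V) (A A' : Submodule F V) :
    B.orthogonal (A ⊔ A') = B.orthogonal A ⊓ B.orthogonal A' := by
  refine le_antisymm (le_inf (LinearMap.BilinForm.orthogonal_le le_sup_left)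
    (LinearMap.BilinForm.orthogonal_le le_sup_right)) fun m hm => ?_
  rw [Submodule.mem_inf, LinearMap.BilinForm.mem_orthogonal_iff,
    LinearMap.BilinForm.mem_orthogonal_iff] at hm
  refine LinearMap.BilinForm.mem_orthogonal_iff.2 fun n hn => ?_
  obtain ⟨a, ha, a', ha', rfl⟩ := Submodule.mem_sup.1 hn
  rw [map_add, LinearMap.add_apply, hm.1 a ha, hm.2 a' ha', add_zero]

/-- `(A ∩ B)^⊥ = A^⊥ + B^⊥` for a nondegenerate reflexive form on a finite-dimensional space.
[folklore] -/
theorem orthogonal_inf_eq_sup [FiniteDimensional F V] {B : LinearMap.BilinForm F V}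
    (hnd : B.Nondegenerate) (hrefl : B.IsRefl) (A A' : Submodule F V) :
    B.orthogonal (A ⊓ A') = B.orthogonal A ⊔ B.orthogonal A' := by
  have h := orthogonal_sup_eq_inf B (B.orthogonal A) (B.orthogonal A')
  rw [LinearMap.BilinForm.orthogonal_orthogonal hnd hrefl,
    LinearMap.BilinForm.orthogonal_orthogonal hnd hrefl] at h
  rw [← h, LinearMap.BilinForm.orthogonal_orthogonal hnd hrefl]

/-! ### Lemma 2.2 -/

/-- **KMR Lemma 2.2**: if `X` is Lagrangian and `q(W) = 0`, then `W^⊥ ∩ X + W` is Lagrangian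
("Exercise. See for example [Poonen–Rains]"). Proof: isotropy from `q(X) = q(W) = 0` and `W^⊥ ⊥ W`;
`(W^⊥ ∩ X + W)^⊥ = ((W^⊥)^⊥ + X^⊥) ∩ W^⊥ = (W + X) ∩ W^⊥ = (X ∩ W^⊥) + W` by the modular law
(`W ≤ W^⊥`). [cite: KlagsbrunMazurRubin2013, Lemma 2.2 (arXiv §2 Lemma 2)] -/
theorem isLagrangian_orthogonal_inf_sup [FiniteDimensional F V] (hnd : (polarForm Q).Nondegenerate)
    {X W : Submodule F V} (hX : IsLagrangian Q X) (hW : IsTotallyIsotropic Q W) :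
    IsLagrangian Q (((polarForm Q).orthogonal W ⊓ X) ⊔ W) := by
  have hrefl := polarForm_isRefl Q
  refine ⟨?_, ?_⟩
  · rw [orthogonal_sup_eq_inf, orthogonal_inf_eq_sup hnd hrefl,
      LinearMap.BilinForm.orthogonal_orthogonal hnd hrefl, hX.orthogonal_eq]
    -- `(W + X) ∩ W^⊥ = W + (X ∩ W^⊥)` by modularity, since `W ≤ W^⊥`
    rw [sup_inf_assoc_of_le X hW.le_orthogonal]
    ac_rfl
  · refine (IsTotallyIsotropic.sup (hX.isTotallyIsotropic.mono inf_le_right) hW ?_)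
    intro x hx w hw
    -- `x ∈ W^⊥`, i.e. `(w, x)_q = 0` for all `w ∈ W`
    have hx' := LinearMap.BilinForm.mem_orthogonal_iff.1 (Submodule.mem_inf.1 hx).1 w hw
    rw [polarForm_apply] at hx'
    rw [polar_comm]
    exact hx'


/-! ### Lemma 2.3, Proposition 2.4, Corollary 2.5 -/

section ThreeLagrangians

variable [FiniteDimensional F V] (hnd : (polarForm Q).Nondegenerate)
  {X Y Z : Submodule F V} (hX : IsLagrangian Q X) (hY : IsLagrangian Q Y) (hZ : IsLagrangian Q Z)
include hnd hX hY

/-- `(X ∩ Y)^⊥ = X + Y` for Lagrangians `X`, `Y`. [cite: KlagsbrunMazurRubin2013, §2 (proof of Lemma 2.3)] -/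
theorem orthogonal_inf_of_isLagrangian : (polarForm Q).orthogonal (X ⊓ Y) = X ⊔ Y := by
  rw [orthogonal_inf_eq_sup hnd (polarForm_isRefl Q), hX.orthogonal_eq, hY.orthogonal_eq]

include hZ

/-- `(X + Y) ∩ Z + X ∩ Y` is Lagrangian (Lemma 2.2 with `W = X ∩ Y`, `W^⊥ = X + Y`).
[cite: KlagsbrunMazurRubin2013, §2 (proofs of Lemma 2.3 and Prop. 2.4)] -/
theorem isLagrangian_sup_inf_sup_inf : IsLagrangian Q (((X ⊔ Y) ⊓ Z) ⊔ (X ⊓ Y)) := by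
  have h := isLagrangian_orthogonal_inf_sup hnd hZ
    (hX.isTotallyIsotropic.mono (inf_le_left : X ⊓ Y ≤ X))
  rwa [orthogonal_inf_of_isLagrangian hnd hX hY] at h

/-- **KMR Lemma 2.3**: for Lagrangian subspaces `X, Y, Z` of a nondegenerate quadratic space,
`dim ((X+Y) ∩ Z) ≡ dim (X ∩ Z + Y ∩ Z) (mod 2)`. Proof as printed: `[z, z'] := (x, y')_q` (`z = x + y`,
here for a fixed linear choice of the decomposition) is an alternating pairing on `(X+Y) ∩ Z` whose left and
right kernels contain `X ∩ Z + Y ∩ Z` and whose radical is exactly that subspace (by Lemma 2.2 applied to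
`W = X ∩ Y`); on a complement it is alternating and nondegenerate, hence the complement is
even-dimensional (`even_finrank_of_isAlt_of_nondegenerate`). [cite: KlagsbrunMazurRubin2013, Lemma 2.3 (arXiv §2 Lemma 3)] -/
theorem even_finrank_sup_inf_add_finrank_inf_sup_inf :
    Even (finrank F ↥((X ⊔ Y) ⊓ Z) + finrank F ↥((X ⊓ Z) ⊔ (Y ⊓ Z))) := by
  set U : Submodule F V := (X ⊔ Y) ⊓ Z with hUdef
  set D : Submodule F V := (X ⊓ Z) ⊔ (Y ⊓ Z) with hDdef
  have hDU : D ≤ U :=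
    sup_le (le_inf (inf_le_left.trans le_sup_left) inf_le_right)
      (le_inf (inf_le_left.trans le_sup_right) inf_le_right)
  -- a linear choice of the decomposition `z = x + y` on `X + Y`
  let add : (↥X × ↥Y) →ₗ[F] ↥(X ⊔ Y) :=
    (Submodule.inclusion le_sup_left).coprod (Submodule.inclusion le_sup_right)
  have hadd : LinearMap.range add = ⊤ := by
    rw [LinearMap.range_eq_top]
    rintro ⟨v, hv⟩
    obtain ⟨x, hx, y, hy, rfl⟩ := Submodule.mem_sup.1 hv
    exact ⟨(⟨x, hx⟩, ⟨y, hy⟩), rfl⟩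
  obtain ⟨s, hs⟩ := add.exists_rightInverse_of_surjective hadd
  let ι : ↥U →ₗ[F] ↥(X ⊔ Y) := Submodule.inclusion inf_le_left
  let px : ↥U →ₗ[F] V := X.subtype ∘ₗ LinearMap.fst F ↥X ↥Y ∘ₗ s ∘ₗ ι
  let py : ↥U →ₗ[F] V := Y.subtype ∘ₗ LinearMap.snd F ↥X ↥Y ∘ₗ s ∘ₗ ι
  have hpx : ∀ u : ↥U, px u ∈ X := fun u => (s (ι u)).1.2
  have hpy : ∀ u : ↥U, py u ∈ Y := fun u => (s (ι u)).2.2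
  have hsum : ∀ u : ↥U, px u + py u = (u : V) := fun u => by
    have h := congrArg (fun f : ↥(X ⊔ Y) →ₗ[F] ↥(X ⊔ Y) => ((f (ι u) : ↥(X ⊔ Y)) : V)) hs
    exact h
  have hUZ : ∀ u : ↥U, (u : V) ∈ Z := fun u => (Submodule.mem_inf.1 u.2).2
  -- the pairing `[u, u'] = (x(u), y(u'))_q`
  let P : ↥U →ₗ[F] ↥U →ₗ[F] F := (polarForm Q).compl₁₂ px py
  have hP : ∀ u u' : ↥U, P u u' = polar Q (px u) (py u') := fun u u' => rfl
  -- alternating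
  have halt : P.IsAlt := fun u => by
    rw [hP, polar, hsum u, hZ.isTotallyIsotropic _ (hUZ u), hX.isTotallyIsotropic _ (hpx u),
      hY.isTotallyIsotropic _ (hpy u), sub_zero, sub_zero]
  -- `Y ∩ Z` lies in the left kernel, `X ∩ Z` in the right kernel
  have hYZ : ∀ u : ↥U, (u : V) ∈ Y ⊓ Z → ∀ u' : ↥U, P u u' = 0 := fun u hu u' => by
    have hxY : px u ∈ Y := by
      rw [eq_sub_of_add_eq (hsum u)]
      exact Y.sub_mem (Submodule.mem_inf.1 hu).1 (hpy u)
    rw [hP]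
    exact hY.isTotallyIsotropic.polar_eq_zero hxY (hpy u')
  have hXZ : ∀ u' : ↥U, (u' : V) ∈ X ⊓ Z → ∀ u : ↥U, P u u' = 0 := fun u' hu' u => by
    have hyX : py u' ∈ X := by
      rw [eq_sub_of_add_eq ((add_comm _ _).trans (hsum u'))]
      exact X.sub_mem (Submodule.mem_inf.1 hu').1 (hpx u')
    rw [hP]
    exact hX.isTotallyIsotropic.polar_eq_zero (hpx u) hyX
  -- `D = X ∩ Z + Y ∩ Z` lies in both kernels (skew-symmetry)
  have hDleft : ∀ u : ↥U, (u : V) ∈ D → ∀ u', P u u' = 0 := by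
    intro u hu u'
    obtain ⟨a, ha, b, hb, hab⟩ := Submodule.mem_sup.1 hu
    have haU : a ∈ U := hDU (Submodule.mem_sup_left ha)
    have hbU : b ∈ U := hDU (Submodule.mem_sup_right hb)
    have hu' : u = ⟨a, haU⟩ + ⟨b, hbU⟩ := Subtype.ext hab.symm
    rw [hu', map_add, LinearMap.add_apply, hYZ ⟨b, hbU⟩ hb u', add_zero, ← halt.neg,
      hXZ ⟨a, haU⟩ ha u', neg_zero]
  have hDright : ∀ u' : ↥U, (u' : V) ∈ D → ∀ u, P u u' = 0 := fun u' hu' u => by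
    rw [← halt.neg, hDleft u' hu' u, neg_zero]
  -- the (left) radical is contained in `D` — the heart of the printed proof, via Lemma 2.2
  have hrad : ∀ u : ↥U, (∀ u' : ↥U, P u u' = 0) → (u : V) ∈ D := by
    intro u hu
    have hL := isLagrangian_sup_inf_sup_inf hnd hX hY hZ
    -- `x(u)` is orthogonal to `U` and to `X ∩ Y`, hence lies in the Lagrangian `U + X ∩ Y`
    have hxU : ∀ z' : ↥U, polar Q (z' : V) (px u) = 0 := fun z' => by
      have h0 : polar Q (px u) (py z') = 0 := (hP u z').symm.trans (hu z')
      have h1 : polar Q (px u) (px z') = 0 := hX.isTotallyIsotropic.polar_eq_zero (hpx u) (hpx z')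
      rw [polar_comm, ← hsum z', polar_add_right, h1, h0, add_zero]
    have hxL : px u ∈ ((X ⊔ Y) ⊓ Z) ⊔ (X ⊓ Y) := by
      refine hL.mem_of_forall_polar_eq_zero fun v hv => ?_
      obtain ⟨z', hz', w, hw, rfl⟩ := Submodule.mem_sup.1 hv
      rw [polar_add_left, hxU ⟨z', hz'⟩,
        hX.isTotallyIsotropic.polar_eq_zero (Submodule.mem_inf.1 hw).1 (hpx u), add_zero]
    obtain ⟨z', hz', w, hw, hzw⟩ := Submodule.mem_sup.1 hxL
    have hz'Z : (z' : V) ∈ Z := (Submodule.mem_inf.1 hz').2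
    have hxw : px u - w = z' := by rw [← hzw, add_sub_cancel_right]
    refine Submodule.mem_sup.2 ⟨px u - w, ?_, py u + w, ?_, ?_⟩
    · exact Submodule.mem_inf.2 ⟨X.sub_mem (hpx u) (Submodule.mem_inf.1 hw).1, hxw ▸ hz'Z⟩
    · refine Submodule.mem_inf.2 ⟨Y.add_mem (hpy u) (Submodule.mem_inf.1 hw).2, ?_⟩
      have : py u + w = (u : V) - (px u - w) := by rw [← hsum u]; abel
      rw [this]
      exact Z.sub_mem (hUZ u) (hxw ▸ hz'Z)
    · rw [← hsum u]
      abel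
  -- restrict to a complement `C` of `D` in `U`: alternating and nondegenerate, hence even-dimensional
  let DU : Submodule F ↥U := D.comap U.subtype
  obtain ⟨C, hC⟩ := DU.exists_isCompl
  let PC : LinearMap.BilinForm F ↥C := P.compl₁₂ C.subtype C.subtype
  have hPCalt : PC.IsAlt := fun c => halt c
  have hPCnd : PC.Nondegenerate := by
    rw [LinearMap.BilinForm.Nondegenerate,
      (LinearMap.IsAlt.isRefl hPCalt).nondegenerate_iff_separatingLeft]
    intro c hc
    have hcu : ∀ u' : ↥U, P (c : ↥U) u' = 0 := fun u' => by
      have hu' : u' ∈ DU ⊔ C := by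
        rw [hC.sup_eq_top]
        exact Submodule.mem_top
      obtain ⟨d, hd, c', hc', rfl⟩ := Submodule.mem_sup.1 hu'
      rw [map_add, hDright d hd, zero_add]
      exact hc ⟨c', hc'⟩
    have hcDU : (c : ↥U) ∈ DU ⊓ C := Submodule.mem_inf.2 ⟨hrad _ hcu, c.2⟩
    rw [hC.inf_eq_bot, Submodule.mem_bot] at hcDU
    exact Subtype.ext hcDU
  have heven : Even (finrank F ↥C) :=
    Literature.GroupTheory.FiniteAbelian.even_finrank_of_isAlt_of_nondegenerate hPCalt hPCnd
  have h1 : finrank F ↥DU + finrank F ↥C = finrank F ↥U := Submodule.finrank_add_eq_of_isCompl hC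
  have h2 : finrank F ↥DU = finrank F ↥D := (Submodule.comapSubtypeEquivOfLe hDU).finrank_eq
  obtain ⟨m, hm⟩ := heven
  exact ⟨m + finrank F ↥D, by omega⟩

/-- **KMR Proposition 2.4**: for Lagrangian subspaces `X, Y, Z` of a nondegenerate quadratic space,
`dim X∩Y + dim Y∩Z + dim X∩Z ≡ dim X = ½ dim V (mod 2)`. Proof as printed:
`dim U + dim W = dim (U+W) + dim (U ∩ W)` twice, Lemma 2.3, and `(X+Y) ∩ Z + X ∩ Y` Lagrangian hence of
dimension `dim X`. [cite: KlagsbrunMazurRubin2013, Prop. 2.4 (arXiv §2 Prop. 4)] -/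
theorem even_finrank_inf_add_finrank_inf_add_finrank_inf_add_finrank :
    Even (finrank F ↥(X ⊓ Y) + finrank F ↥(Y ⊓ Z) + finrank F ↥(X ⊓ Z) + finrank F X) := by
  have e1 := Submodule.finrank_sup_add_finrank_inf_eq (X ⊓ Z) (Y ⊓ Z)
  have hT1 : (X ⊓ Z) ⊓ (Y ⊓ Z) = X ⊓ Y ⊓ Z := by
    refine le_antisymm ?_ ?_
    · exact le_inf (le_inf (inf_le_left.trans inf_le_left) (inf_le_right.trans inf_le_left))
        (inf_le_left.trans inf_le_right)
    · exact le_inf (le_inf (inf_le_left.trans inf_le_left) inf_le_right)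
        (le_inf (inf_le_left.trans inf_le_right) inf_le_right)
  rw [hT1] at e1
  have e2 := even_finrank_sup_inf_add_finrank_inf_sup_inf hnd hX hY hZ
  have e3 := Submodule.finrank_sup_add_finrank_inf_eq ((X ⊔ Y) ⊓ Z) (X ⊓ Y)
  have hT2 : ((X ⊔ Y) ⊓ Z) ⊓ (X ⊓ Y) = X ⊓ Y ⊓ Z :=
    le_antisymm (le_inf inf_le_right (inf_le_left.trans inf_le_right))
      (le_inf (le_inf (inf_le_left.trans (inf_le_left.trans le_sup_left)) inf_le_right) inf_le_left)
  rw [hT2] at e3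
  have e4 : finrank F ↥(((X ⊔ Y) ⊓ Z) ⊔ (X ⊓ Y)) = finrank F X := by
    have h := (isLagrangian_sup_inf_sup_inf hnd hX hY hZ).two_mul_finrank hnd
    have h' := hX.two_mul_finrank hnd
    omega
  obtain ⟨m, hm⟩ := e2
  refine ⟨m + finrank F ↥(X ⊓ Y), ?_⟩
  omega

/-- **KMR Corollary 2.5**: `dim X/(X ∩ Y) + dim Y/(Y ∩ Z) + dim Z/(X ∩ Z) ≡ 0 (mod 2)` for Lagrangians
`X, Y, Z` — written with `dim X − dim (X ∩ Y)` etc. (quotient dimensions).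
[cite: KlagsbrunMazurRubin2013, Cor. 2.5 (arXiv §2 Cor. 5)] -/
theorem even_finrank_sub_add :
    Even ((finrank F X - finrank F ↥(X ⊓ Y)) + (finrank F Y - finrank F ↥(Y ⊓ Z)) +
      (finrank F Z - finrank F ↥(X ⊓ Z))) := by
  have h := even_finrank_inf_add_finrank_inf_add_finrank_inf_add_finrank hnd hX hY hZ
  have hXd := hX.two_mul_finrank hnd
  have hYd := hY.two_mul_finrank hnd
  have hZd := hZ.two_mul_finrank hnd
  have l1 : finrank F ↥(X ⊓ Y) ≤ finrank F X := Submodule.finrank_mono inf_le_left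
  have l2 : finrank F ↥(Y ⊓ Z) ≤ finrank F Y := Submodule.finrank_mono inf_le_left
  have l3 : finrank F ↥(X ⊓ Z) ≤ finrank F Z := Submodule.finrank_mono inf_le_right
  obtain ⟨m, hm⟩ := h
  refine ⟨m + finrank F X - (finrank F ↥(X ⊓ Y) + finrank F ↥(Y ⊓ Z) + finrank F ↥(X ⊓ Z)), ?_⟩
  omega

end ThreeLagrangians

/-! ### The stub form: isotropic half-dimensional subspaces, left-separating polar form -/

/-- **Three-Lagrangian parity, in the shape of the stub `stub_threeLagrangianParity`** (crux lines on
`stmt-Parity-11584`, `Cruxes/PencilSelmerDictionary/Lines/isotrivial-two-torsion-relative-parity.lean`;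
the stub is the instance `F = ZMod 2`): over any field, for a quadratic form whose polar pairing is
left-separating and three totally isotropic half-dimensional (hence Lagrangian) subspaces `X, Y, Z`,
`dim X∩Y + dim Y∩Z + dim Z∩X + dim X` is even — KMR Prop. 2.4.
[cite: KlagsbrunMazurRubin2013, Prop. 2.4 (arXiv §2 Prop. 4)] -/
theorem threeLagrangianParity (F : Type*) [Field F] (V : Type*) [AddCommGroup V] [Module F V]
    [Module.Finite F V] (Q : QuadraticForm F V)
    (hnd : ∀ x : V, (∀ y : V, QuadraticMap.polar Q x y = 0) → x = 0)
    (X Y Z : Submodule F V)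
    (hX : ∀ x ∈ X, Q x = 0) (hY : ∀ y ∈ Y, Q y = 0) (hZ : ∀ z ∈ Z, Q z = 0)
    (hXd : 2 * Module.finrank F X = Module.finrank F V) (hYd : 2 * Module.finrank F Y = Module.finrank F V)
    (hZd : 2 * Module.finrank F Z = Module.finrank F V) :
    Even (Module.finrank F ↥(X ⊓ Y) + Module.finrank F ↥(Y ⊓ Z) + Module.finrank F ↥(Z ⊓ X) +
      Module.finrank F X) := by
  have hnd' : (polarForm Q).Nondegenerate := (polarForm_nondegenerate_iff Q).2 hnd
  have hXL := isLagrangian_of_isTotallyIsotropic_of_two_mul_finrank_eq hnd' hX hXd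
  have hYL := isLagrangian_of_isTotallyIsotropic_of_two_mul_finrank_eq hnd' hY hYd
  have hZL := isLagrangian_of_isTotallyIsotropic_of_two_mul_finrank_eq hnd' hZ hZd
  rw [inf_comm Z X]
  exact even_finrank_inf_add_finrank_inf_add_finrank_inf_add_finrank hnd' hXL hYL hZL


/-! ### The algebraic skeleton of KMR Theorem 3.9 (relative parity of Selmer ranks) -/

/-- **KMR Theorem 3.9, algebraic skeleton.** In the proof of Thm. 3.9 (relative parity of Selmer ranks for
two Selmer structures `𝒮, 𝒮'` on a self-dual `𝔽_p[G_K]`-module `T` with a global metabolic structure) one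
has `V = ⊕_{v ∈ Σ'} H¹(K_v, T)` with `Q = Σ_v q_v` (nondegenerate), the Lagrangians `X = ⊕_v H¹_𝒮(K_v, T)`,
`Y = ⊕_v H¹_{𝒮'}(K_v, T)` (by definition of a Selmer structure) and `Z = loc_{Σ'}(H¹(K_{Σ'}/K, T))`
(Lagrangian by Poitou–Tate duality and Def. 3.2 (ii), (iii)), and the Selmer groups are
`H¹_𝒮(K, T) = loc⁻¹(X)`, `H¹_{𝒮'}(K, T) = loc⁻¹(Y)` with common kernel `A = ker loc`; then
"by Proposition 2.4, `dim H¹_𝒮(K,T) − dim H¹_{𝒮'}(K,T) = dim (X ∩ Z) − dim (Y ∩ Z) ≡ dim X/(X ∩ Y) (mod 2)`".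
This theorem is exactly that step, for ANY finite-dimensional `H`, linear `loc : H → V` with Lagrangian
image, and Lagrangians `X, Y`: `dim loc⁻¹(X) + dim loc⁻¹(Y) + dim X/(X ∩ Y)` is even (the arithmetic
inputs — local Tate duality, Poitou–Tate, the reciprocity law for `(q_v)` — are what makes `X, Y, Z`
Lagrangian there; `dim X/(X ∩ Y) = Σ_v dim H¹_𝒮(K_v,T)/(H¹_𝒮(K_v,T) ∩ H¹_{𝒮'}(K_v,T))` for the direct sums).
[cite: KlagsbrunMazurRubin2013, Thm. 3.9 (arXiv §3 Thm. 14), proof] -/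
theorem even_finrank_comap_add_finrank_comap_add_finrank_sub [FiniteDimensional F V]
    (hnd : (polarForm Q).Nondegenerate) {X Y : Submodule F V} (hX : IsLagrangian Q X)
    (hY : IsLagrangian Q Y) {H : Type*} [AddCommGroup H] [Module F H] [FiniteDimensional F H]
    (loc : H →ₗ[F] V) (hZ : IsLagrangian Q (LinearMap.range loc)) :
    Even (finrank F ↥(X.comap loc) + finrank F ↥(Y.comap loc) + (finrank F X - finrank F ↥(X ⊓ Y))) := by
  -- rank–nullity for `loc` restricted to `loc⁻¹(W)`: `dim loc⁻¹(W) = dim ker loc + dim (W ∩ im loc)`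
  have key : ∀ W : Submodule F V, finrank F ↥(W.comap loc) =
      finrank F ↥(LinearMap.ker loc) + finrank F ↥(W ⊓ LinearMap.range loc) := by
    intro W
    let f : ↥(W.comap loc) →ₗ[F] V := loc ∘ₗ (W.comap loc).subtype
    have hrange : LinearMap.range f = W ⊓ LinearMap.range loc := by
      ext v
      constructor
      · rintro ⟨⟨h, hh⟩, rfl⟩
        exact ⟨hh, ⟨h, rfl⟩⟩
      · rintro ⟨hv, h, rfl⟩
        exact ⟨⟨h, hv⟩, rfl⟩
    have hle : LinearMap.ker loc ≤ W.comap loc := fun h hh => by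
      rw [Submodule.mem_comap, LinearMap.mem_ker.1 hh]
      exact W.zero_mem
    have hker : LinearMap.ker f = (LinearMap.ker loc).comap (W.comap loc).subtype := by
      ext ⟨h, hh⟩
      rfl
    have rn := LinearMap.finrank_range_add_finrank_ker f
    rw [hrange, hker, (Submodule.comapSubtypeEquivOfLe hle).finrank_eq] at rn
    omega
  have h24 := even_finrank_inf_add_finrank_inf_add_finrank_inf_add_finrank hnd hX hY hZ
  rw [key X, key Y]
  have l1 : finrank F ↥(X ⊓ Y) ≤ finrank F X := Submodule.finrank_mono inf_le_left
  obtain ⟨m, hm⟩ := h24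
  refine ⟨finrank F ↥(LinearMap.ker loc) + m - finrank F ↥(X ⊓ Y), ?_⟩
  omega

end Literature.LinearAlgebra.QuadraticForm

end
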